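/-
HarnessLib.Audit.Status.Classify — the DERIVED half of the status layer (ARCHITECTURE.md §1.1/§1.3): reads
`HarnessLib.tagExt` (the four attributes + the cite-family alias) and the TYPES of landed theorems and computes

* for every NODE (Statement decl or `@[crux]` def): `open | proved | refuted | closed_mod_print | closed_mod_claim` —
  TIER K, from theorem types only — plus the tier-J notes carried by `@[crux]` and the evidence/barrier edge lists;
* every THESIS (a kernel-checked theorem `H₁ → … → Hₖ → G`, `G` a node, ≥ 1 `Hᵢ` a node): `open | closed | dead`;
* a fixpoint: a closed thesis closes its target node, a refuted node kills every thesis through it.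

Imported ONLY by status roots (`Summits/<S>/Status/Root.lean`), the `status` executable (`Main.lean`) and gate
probes — never by tree files, so editing the report never rebuilds the tree (same split as
`HarnessLib.Audit.Tags` / `HarnessLib.Audit.Check`). Commands: `#status …` (humans, in a file) and `#status_root S`
(body of a root file: computes the summit's report at build time, stores it in the root's `.olean`, logs NOTHING).

READING RULES (by-name policy, no `whnf`, no unfolding — an `abbrev C' := C` concluded as `C'` is NOT `C`):
  theorem type, ∀-telescope opened once (`forallTelescope`, memoised per theorem):
    `∀ params, H₁ → … → Hₖ → C a₁…aₙ`      positive conclusion, head `C`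
    `… → ¬ C a⃗` / `… → C a⃗ → False`         negative conclusion (the two accepted spellings of a refutation)
  EXACT  ⇔ the `aᵢ` are pairwise-distinct bound variables of the theorem, every non-Prop non-instance binder is one of
           them, and `C`'s universe arguments are distinct level parameters (⇒ the type is the universal closure of
           `C` over its own parameters, modulo the Prop hypotheses `Hᵢ`);
  hypotheses = the Prop-typed binders that are not conclusion arguments, classified by HEAD constant:
           node · printed · claim (FACT CLASSES below) · inst (a Prop-valued instance binder such as `[Fact P]`:
           never a fact, never neutral — it blocks credit) · other;  non-Prop instance binders are neutral (skipped).
  CREDIT (tier K) needs: exact ∧ axioms ⊆ {propext, Classical.choice, Quot.sound} ∧ (conclusion has no arguments ∨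
           `Config.creditParametrised`) — a parametrised crux proved in full generality is reported as
           `param_instances` (info) but not counted unless the knob is set (conservative default, coordinator 2026-09-01).
  | hypotheses of an exact clean theorem concluding node C | derived                                            |
  |-------------------------------------------------------|----------------------------------------------------|
  | none, positive                                         | C **proved**                                       |
  | none, negative                                         | C **refuted**                                      |
  | all printed, positive                                  | C **closed_mod_print** [facts not yet discharged]  |
  | printed-or-claim with ≥ 1 CLAIM, positive              | C **closed_mod_claim** [claims; facts] — never counted as mod-print |
  | printed-or-claim with ≥ 1 CLAIM, negative              | `conditional` (a refutation modulo a claim is never credited) |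
  | ≥ 1 node (rest printed/claim), positive / negative     | a **thesis** targeting C (negative = refutation route) |
  | anything else (other/inst hyps, non-exact, instance)   | `conditional` — listed, NEVER credited             |
  | would credit but reaches `sorryAx` / a foreign axiom   | `pending` — listed, NEVER credited                 |
  precedence refuted > proved > closed_mod_print > closed_mod_claim > open; refuted ∧ (proved ∨ closed_mod_print) ⇒
  `conflict` flag. A fact (printed or claim) with an exact clean proof in the cone is DISCHARGED (drops out of the
  mod lists); one with an exact clean refutation poisons every closer that assumes it (moved to `conditional`).

FACT CLASSES (v3, coordinator 2026-09-02 — a CLASS, not a cite tier; the human ruled tiers out):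
  printed  a refereed, published statement typed as a named fact: `@[printed (cite := …)]`, `@[cite …]`, `@[folklore]`,
           `@[cite_pending]`, docstring `[cite: …]` / `[cite]` / `[folklore]` / `[cite pending]` (alias table, `Attr.lean`);
  claim    an UNREFEREED preprint's assertion — a different object, never merged with printed in any count:
           `@[claim "Key" "status"]`, docstring `[claim: …]` / `[claim]`, or ANY Prop def living under
           `Config.claimsPrefix` (`Literature.Claims.*`, by declaration name or by module) WHATEVER its marker — a
           `[cite: …]`-marked or unmarked step of a claim skeleton is still a claim (e.g. `Literature.Claims.NS.Xu2024.*`).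
  (The alias-table rows of `Attr.lean` that read `@[claim …]` / `[claim: …]` "as printed" are superseded by this split;
  `Attr.lean` is unchanged so that its 500+ importers do not rebuild.)
-/
import Lean
import HarnessLib.Audit.Status.Attr

open Lean Meta Elab Command

namespace HarnessLib.Status

/-! ## Knobs (function parameters — no `set_option`) -/

/-- Classification knobs. Defaults = the tree's conventions. -/
structure Config where
  /-- module roots whose theorems / statements / facts are scanned -/
  scanRoots : List Name := [`Summits, `Literature]
  /-- modules `<summitRoot>.<S>.…` belong to summit `S`; statement modules are `<summitRoot>.<S>(.<Sub>)?.Statement` -/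
  summitRoot : Name := `Summits
  /-- module root under which docstring-form cite tags make a Prop def a printed fact (alias table, `Attr.lean`) -/
  literatureRoot : Name := `Literature
  /-- read docstring-form `[cite: …]` / `[folklore]` / `[cite pending]` as printed and `[claim: …]` as claim (99 % of today's tree) -/
  docTags : Bool := true
  /-- every Prop def whose declaration name OR module lies under this prefix is fact class `claim` (an unrefereed
  preprint's assertion), whatever cite marker it carries — even none -/
  claimsPrefix : Name := `Literature.Claims
  /-- ALSO treat legacy `@[route_item r "crux"]` and `@[conjecture]` Prop defs (HarnessLib.Audit.Tags) as cruxes with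
  unknown bottleneck — off by default (the architecture's tagging pass makes crux-hood an explicit `@[crux]`) -/
  legacyCruxTags : Bool := false
  /-- credit `∀ params, C params` proofs of PARAMETRISED nodes as proved/refuted (sound; off = conservative default) -/
  creditParametrised : Bool := false
  /-- a statement `def S : Prop := C₁ ∧ … ∧ Cₙ` (conjuncts constants) counts as the implicit thesis `C₁ → … → Cₙ → S` -/
  conjunctStatements : Bool := true
  /-- also scan the declarations of the module being elaborated (`#status` at the end of a work file) -/
  includeHere : Bool := true
  deriving Inhabited, Repr

def axiomWhitelist : List Name := [``propext, ``Classical.choice, ``Quot.sound]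

/-- Summit of a module: `<summitRoot>.<S>.…` ↦ `S`; any other module ↦ its root (`Literature`, …). -/
def summitOfModule (cfg : Config) (m : Name) : String :=
  match m.components with
  | r :: s :: _ => if r == cfg.summitRoot then s.toString else r.toString
  | [r] => r.toString
  | [] => "_here"

/-- `m` = `<summitRoot>.<S>.Statement` exactly (the TOP statement module of summit `S`). -/
def isTopStatementModule (cfg : Config) (m : Name) : Bool :=
  match m.components with
  | [r, _, s] => r == cfg.summitRoot && s == `Statement
  | _ => false

/-! ## Pass 1 (pure, ONE pass over the scanned modules): conclusion-head index + statement decls -/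

/-- Key under which a theorem TYPE is indexed: head constant of its conclusion, looking through `¬ X` / `Not X` and
the `… → X → False` spelling. Pure walk down the `∀`/`→` spine only (binder domains are never traversed). -/
def conclusionKey? (type : Expr) : Option Name :=
  go type none
where
  go : Expr → Option Expr → Option Name
    | .forallE _ d b _, _ => go b (some d)
    | .mdata _ e, last => go e last
    | e, last =>
      match e.not? with
      | some t => t.consumeMData.getAppFn.constName?
      | none =>
        if e.isConstOf ``False then last.bind fun d => d.consumeMData.getAppFn.constName?
        else e.getAppFn.constName?

/-- Result of pass 1. -/
structure Index where
  /-- conclusion head ↦ theorems concluding it (positively or negatively); only PROJECT heads are kept -/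
  byHead     : Std.HashMap Name (Array Name) := {}
  /-- closed Prop defs declared in statement modules -/
  statements : Array Name := #[]
  nModules   : Nat := 0
  nTheorems  : Nat := 0
  deriving Inhabited

namespace Index

/-- Is `n` declared in a scanned module (or in the file being elaborated)? Library heads (`Eq`, `LE.le`, …) are not
indexed: they can never be nodes or facts, and skipping them keeps the hot buckets out of the map. -/
private def projectHead (env : Environment) (cfg : Config) (n : Name) : Bool :=
  match declModule? env n with
  | none => true
  | some m => cfg.scanRoots.contains m.getRoot

private def addConst (env : Environment) (cfg : Config) (ix : Index) (ci : ConstantInfo) (m : Name) : Index :=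
  if ci.name.isInternalDetail then ix else
  match ci with
  | .thmInfo ti =>
    let ix := { ix with nTheorems := ix.nTheorems + 1 }
    match conclusionKey? ti.type with
    | some k =>
      if projectHead env cfg k then
        { ix with byHead := ix.byHead.alter k fun | none => some #[ti.name] | some a => some (a.push ti.name) }
      else ix
    | none => ix
  | .defnInfo di =>
    if isStatementModuleName m && m.getRoot == cfg.summitRoot && di.type.isProp then
      { ix with statements := ix.statements.push di.name }
    else ix
  | _ => ix

/-- ONE pass: constants of every imported module whose root ∈ `cfg.scanRoots` (via `header.moduleData`, never
`env.constants.fold`), plus — `cfg.includeHere` — the declarations of the module being elaborated. Linear. -/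
def build (env : Environment) (cfg : Config) : Index := Id.run do
  let mut ix : Index := {}
  let mods := env.header.modules            -- NOT `header.moduleNames` (rebuilds the array per call)
  for h : i in [0:mods.size] do
    let m := mods[i].module
    unless cfg.scanRoots.contains m.getRoot do continue
    let some md := env.header.moduleData[i]? | continue
    ix := { ix with nModules := ix.nModules + 1 }
    for ci in md.constants do
      ix := addConst env cfg ix ci m
  if cfg.includeHere then
    let here := env.mainModule
    ix := env.constants.foldStage2 (fun ix _ ci => addConst env cfg ix ci here) ix
    ix := { ix with nModules := ix.nModules + 1 }
  return ix

def candidates (ix : Index) (head : Name) : Array Name := ix.byHead.getD head #[]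

end Index

/-! ## Pass 2 (MetaM, candidates only): one theorem type read as glue -/

/-- Class of a Prop hypothesis by head constant: an obligation NODE, a PRINTED fact, an unrefereed CLAIM, a Prop-valued
instance binder, or anything else. -/
inductive HypCls | node | printed | claim | inst | other
  deriving Inhabited, Repr, BEq, DecidableEq

/-- One Prop hypothesis of a candidate theorem (a Prop-typed binder that is not a conclusion argument). -/
structure Hyp where
  binder  : Name
  head?   : Option Name
  /-- the hypothesis applies its head to arguments (`F 3`): by-name policy still reads it as fact `F` (paramsExact=false) -/
  hasArgs : Bool
  cls     : HypCls
  pretty  : String := ""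
  deriving Inhabited, Repr

/-- The glue shape of a theorem `∀ params, H₁ → … → Hₖ → (¬) C a⃗`. -/
structure Shape where
  thm          : Name
  module       : Name
  conclusion   : Name
  negative     : Bool
  /-- conclusion arguments are pairwise-distinct bound variables of the theorem -/
  argsOk       : Bool
  /-- conclusion has no arguments at all (the node is a closed Prop) -/
  closedHead   : Bool
  /-- universe arguments of the conclusion constant are pairwise-distinct level parameters -/
  levelsOk     : Bool
  /-- non-Prop, non-instance binders that are not conclusion arguments (unused data parameters) — break exactness -/
  extraBinders : Array String
  /-- non-Prop instance binders skipped as neutral -/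
  instSkipped  : Nat
  hyps         : Array Hyp
  axioms       : Array Name
  deriving Inhabited, Repr

def Shape.exact (s : Shape) : Bool := s.argsOk && s.levelsOk && s.extraBinders.isEmpty
def Shape.hasSorry (s : Shape) : Bool := s.axioms.contains ``sorryAx
/-- Kernel-closed: no `sorryAx`, no axiom outside the whitelist. -/
def Shape.clean (s : Shape) : Bool := s.axioms.all (axiomWhitelist.contains ·)
def Shape.foreignAxioms (s : Shape) : Array Name := s.axioms.filter fun a => !axiomWhitelist.contains a

private def ppBrief (e : Expr) (n : Nat := 100) : MetaM String := do
  let s ← try pure (← ppExpr e).pretty catch _ => pure (toString e)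
  let s := s.replace "\n" " "
  return if s.length ≤ n then s else String.ofList (s.toList.take n) ++ "…"

/-- Telescope analysis of one candidate (no `whnf`, no unfolding; `instantiateMVars` + `consumeMData` only).
`headCls` classifies a hypothesis head constant (node / printed / other). `none` if `thm` is not a theorem or
its conclusion has no head constant. -/
def analyse (headCls : Name → HypCls) (thm : Name) : MetaM (Option Shape) := do
  let env ← getEnv
  let some (.thmInfo ti) := env.find? thm | return none
  let module := (declModule? env thm).getD env.mainModule
  forallTelescope ti.type fun xs body => do
    let body := (← instantiateMVars body).consumeMData
    let mut neg := false
    let mut tgt := body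
    let mut bs := xs
    match body.not? with
    | some t => neg := true; tgt := t.consumeMData
    | none =>
      if body.isConstOf ``False && 0 < xs.size then
        neg := true
        tgt := (← instantiateMVars (← inferType xs.back!)).consumeMData
        bs := xs.pop
    let .const c lvls := tgt.getAppFn | return none
    let args := tgt.getAppArgs
    let argsOk := args.all (fun a => a.isFVar && bs.contains a) && args.toList.eraseDups.length == args.size
    let levelsOk := lvls.all (· matches .param _) && lvls.eraseDups.length == lvls.length
    let mut hyps : Array Hyp := #[]
    let mut extra : Array String := #[]
    let mut instSkipped := 0
    for x in bs do
      if args.contains x then continue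
      let ld ← x.fvarId!.getDecl
      let ty := (← instantiateMVars ld.type).consumeMData
      if ← isProp ty then
        let head? := ty.getAppFn.constName?
        let cls := if ld.binderInfo.isInstImplicit then HypCls.inst else match head? with
          | some h => headCls h
          | none => .other
        let pretty ← if cls == .other || cls == .inst then ppBrief ty else pure ""
        hyps := hyps.push { binder := ld.userName, head?, hasArgs := ty.getAppNumArgs > 0, cls, pretty }
      else if ld.binderInfo.isInstImplicit then
        instSkipped := instSkipped + 1
      else
        extra := extra.push s!"{ld.userName} : {← ppBrief ty 60}"
    let axioms ← collectAxioms thm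
    return some { thm, module, conclusion := c, negative := neg, argsOk, closedHead := args.isEmpty, levelsOk,
                  extraBinders := extra, instSkipped, hyps, axioms }

/-! ## Report types (JSON = the derived instances; `status_version` 2) -/

/-- A crediting theorem: `facts` = PRINTED facts still assumed, `claims` = unrefereed CLAIMS still assumed (both empty ⇒
unconditional; `claims` non-empty ⇒ the closer lives in `modClaim`, never in `modPrint`);
`via` = direct | thesis | conjuncts | facts-discharged. -/
structure Closer where
  thm    : Name
  facts  : Array Name := #[]
  claims : Array Name := #[]
  via    : String := "direct"
  deriving Inhabited, Repr, ToJson, FromJson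

/-- A theorem concluding the node that is NOT credited, with the reason. -/
structure CondInfo where
  thm    : Name
  reason : String
  deriving Inhabited, Repr, ToJson, FromJson

/-- Tier-J notes of a node (shown only with `--with-notes`). -/
structure Notes where
  bottleneck : Option String := none
  experiment : Option String := none
  source     : Option String := none
  /-- registered through the legacy alias (`@[route_item … "crux"]` / `@[conjecture]`), not `@[crux]` -/
  legacy     : Bool := false
  deriving Inhabited, Repr, ToJson, FromJson

structure NodeReport where
  decl        : Name
  /-- `statement` | `crux` -/
  kind        : String
  summit      : String
  module      : Name
  /-- `open` | `proved` | `refuted` | `closed_mod_print` | `closed_mod_claim` — TIER K -/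
  status      : String := "open"
  /-- this statement lives in the summit's TOP statement module (or is the statement named like its summit) -/
  top         : Bool := false
  arity       : Nat := 0
  provedBy    : Array Closer := #[]
  refutedBy   : Array Closer := #[]
  /-- closers assuming only PRINTED facts (all undischarged ones listed in `.facts`) -/
  modPrint    : Array Closer := #[]
  /-- closers assuming ≥ 1 unrefereed CLAIM (`.claims`), plus possibly printed facts (`.facts`) — never counted as mod-print -/
  modClaim    : Array Closer := #[]
  conditional : Array CondInfo := #[]
  /-- would credit, but the proof reaches `sorryAx` / a non-whitelisted axiom -/
  pending     : Array CondInfo := #[]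
  /-- exact clean proofs/refutations of a PARAMETRISED node in full generality — not credited unless `creditParametrised` -/
  paramInstances : Array Name := #[]
  /-- theses (incl. implicit conjunct theses) using this node as a hypothesis -/
  usedBy      : Array Name := #[]
  orphan      : Bool := false
  /-- refuted AND (proved or closed_mod_print): inconsistent tree or a false printed fact — loud -/
  conflict    : Bool := false
  evidence    : Array Name := #[]
  barriers    : Array Name := #[]
  notes       : Notes := {}
  deriving Inhabited, Repr, ToJson, FromJson

structure ThesisReport where
  thm          : Name
  module       : Name
  summit       : String
  target       : Name
  targetKind   : String
  /-- refutation route: concludes `¬ target` from its hypotheses -/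
  negative     : Bool := false
  /-- the statement's own definition `S := C₁ ∧ … ∧ Cₙ` read as a thesis (no theorem object) -/
  implicit     : Bool := false
  nodes        : Array Name
  printed      : Array Name := #[]
  /-- hypotheses that are unrefereed CLAIMS (fact class `claim`) — a thesis closing through them closes its target mod CLAIM -/
  claims       : Array Name := #[]
  /-- hypotheses that are neither nodes nor printed facts nor claims (a thesis with any can never close) -/
  extra        : Array String := #[]
  exact        : Bool := true
  /-- the thesis' own proof reaches `sorryAx` / a foreign axiom -/
  unproved     : Bool := false
  /-- `open` | `closed` | `dead` -/
  status       : String := "open"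
  openNodes    : Array Name := #[]
  refutedNodes : Array Name := #[]
  deriving Inhabited, Repr, ToJson, FromJson

/-- A FACT in use (printed fact or unrefereed claim — `cls` tells which; the two classes are never merged). -/
structure PrintedReport where
  decl         : Name
  module       : Name
  /-- how the tag is WRITTEN: `printed` | `cite` | `claim` | `folklore` | `cite_pending` | `doc:cite` | `doc:claim` |
  `doc:folklore` | `doc:cite_pending` | `namespace:<claimsPrefix>` (a Prop def under the claims prefix with no marker) -/
  form         : String
  /-- fact CLASS: `printed` (refereed, published) | `claim` (unrefereed preprint assertion: `@[claim]`, `[claim: …]`, or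
  under `Config.claimsPrefix` whatever the marker) -/
  cls          : String := "printed"
  cite         : String := ""
  arity        : Nat := 0
  /-- exact clean proofs of the fact in the cone (⇒ discharged: no longer an assumption) -/
  dischargedBy : Array Name := #[]
  refutedBy    : Array Name := #[]
  /-- closers / theses assuming it -/
  usedBy       : Array Name := #[]
  deriving Inhabited, Repr, ToJson, FromJson

structure EdgeReport where
  thm    : Name
  target : Name
  attr   : String
  deriving Inhabited, Repr, ToJson, FromJson

structure LintItem where
  code : String
  decl : Name
  msg  : String
  deriving Inhabited, Repr, ToJson, FromJson

structure SummitLine where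
  summit     : String
  /-- top statement decl(s) and their status; empty if the summit has no top statement module in the cone -/
  statements : Array (Name × String) := #[]
  nodes      : Nat := 0
  «open»     : Nat := 0
  proved     : Nat := 0
  refuted    : Nat := 0
  modPrint   : Nat := 0
  /-- nodes closed modulo ≥ 1 unrefereed claim — NOT included in `modPrint` -/
  modClaim   : Nat := 0
  theses     : Nat := 0
  orphans    : Nat := 0
  deriving Inhabited, Repr, ToJson, FromJson

/-- Schema version of `Report` (3 = fact classes: `Closer.claims`, `NodeReport.modClaim`, `ThesisReport.claims`,
`PrintedReport.cls`, `SummitLine.modClaim`, status `closed_mod_claim`). Stored reports of another version are skipped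
by the executable with a rebuild hint. -/
def statusVersion : Nat := 3

structure Report where
  status_version  : Nat := statusVersion
  root            : Name
  /-- `some S` when produced by `#status_root S` (restricted to one summit) -/
  summit          : Option String := none
  scannedModules  : Nat := 0
  scannedTheorems : Nat := 0
  config          : String := ""
  summits         : Array SummitLine := #[]
  nodes           : Array NodeReport := #[]
  theses          : Array ThesisReport := #[]
  printed         : Array PrintedReport := #[]
  /-- `@[evidence_for X]` / `@[barrier X]` whose `X` is not a node -/
  strayEdges      : Array EdgeReport := #[]
  /-- tier-J diagnostics: `crux.bottleneck-missing`, `edge.target-not-node`, `printed.conjecture-cited`, … -/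
  lints           : Array LintItem := #[]
  deriving Inhabited, Repr, ToJson, FromJson

/-! ## The classifier -/

private def dedupNames (xs : Array Name) : Array Name :=
  (xs.foldl (fun (s : Std.HashSet Name × Array Name) x => if s.1.contains x then s else (s.1.insert x, s.2.push x)) ({}, #[])).2

/-- Constants of the `∧`-spine of a definition value `C₁ ∧ (C₂ ∧ …)`; `none` if some conjunct is not a bare constant
or there is only one conjunct. -/
private partial def conjuncts? (v : Expr) : Option (Array Name) :=
  let rec go (e : Expr) (acc : Array Name) : Option (Array Name) :=
    match e.consumeMData.and? with
    | some (a, b) => match a.consumeMData with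
      | .const n _ => go b (acc.push n)
      | _ => none
    | none => match e.consumeMData with
      | .const n _ => some (acc.push n)
      | _ => none
  match go v #[] with
  | some cs => if cs.size ≥ 2 then some cs else none
  | none => none

/-- THE classifier. `MetaM` only for the candidate telescopes; everything else is table lookups. Linear in the
number of scanned constants + (candidates × telescope size) + fixpoint rounds × theses. -/
def classify (cfg : Config := {}) : MetaM Report := do
  let env ← getEnv
  -- (0) tag tables, once ------------------------------------------------------------------------------------------
  let tagEntries := allTagEntries env
  let tagsByDecl : Std.HashMap Name (Array HarnessLib.TagEntry) :=
    tagEntries.foldl (fun m t => m.alter t.decl fun | none => some #[t] | some a => some (a.push t)) {}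
  let auditRecs := (HarnessLib.Audit.auditTagExt.getState env).recs
  let conjSet : Std.HashSet Name := auditRecs.foldl (fun s (r, _) => if r.attr == `conjecture then s.insert r.decl else s) {}
  let legacyCruxSet : Std.HashSet Name :=
    if cfg.legacyCruxTags then
      auditRecs.foldl (fun s (r, _) =>
        if (r.attr == `route_item_kind && r.arg == "crux") || r.attr == `conjecture then s.insert r.decl else s) {}
    else {}
  let inScope (n : Name) : Bool := match declModule? env n with
    | none => cfg.includeHere
    | some m => cfg.scanRoots.contains m.getRoot
  let moduleOf (n : Name) : Name := (declModule? env n).getD env.mainModule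
  -- (1) pass 1 --------------------------------------------------------------------------------------------------------
  let ix := Index.build env cfg
  -- (2) nodes: statements ∪ @[crux] (∪ legacy) ----------------------------------------------------------------------
  let mut nodeArr : Array NodeReport := #[]
  let mut nodeIdx : Std.HashMap Name Nat := {}
  let mut lints : Array LintItem := #[]
  for s in ix.statements do
    unless nodeIdx.contains s do
      let m := moduleOf s
      nodeIdx := nodeIdx.insert s nodeArr.size
      nodeArr := nodeArr.push { decl := s, kind := "statement", summit := summitOfModule cfg m, module := m,
                                top := isTopStatementModule cfg m || s == Name.mkSimple (summitOfModule cfg m), arity := 0 }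
  for t in tagEntries do
    if t.attr == cruxAttr && inScope t.decl then
      let info := CruxInfo.ofArgs t.decl t.args
      let notes : Notes := { bottleneck := info.bottleneck.map (·.toString), experiment := info.experiment, source := info.source }
      match nodeIdx[t.decl]? with
      | some i => nodeArr := nodeArr.modify i fun n => { n with notes }     -- a statement carrying @[crux] notes
      | none =>
        let m := moduleOf t.decl
        nodeIdx := nodeIdx.insert t.decl nodeArr.size
        nodeArr := nodeArr.push { decl := t.decl, kind := "crux", summit := summitOfModule cfg m, module := m,
                                  arity := declArity env t.decl, notes }
      if info.bottleneck.isNone then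
        lints := lints.push { code := "crux.bottleneck-missing", decl := t.decl, msg := "@[crux] without (bottleneck := idea|work)" }
  if cfg.legacyCruxTags then
    for n in legacyCruxSet do
      if !nodeIdx.contains n && inScope n && isPropDef env n then
        let m := moduleOf n
        nodeIdx := nodeIdx.insert n nodeArr.size
        nodeArr := nodeArr.push { decl := n, kind := "crux", summit := summitOfModule cfg m, module := m,
                                  arity := declArity env n, notes := { legacy := true } }
  let nodeSet : Std.HashSet Name := nodeArr.foldl (fun s n => s.insert n.decl) {}
  -- (3) fact predicate (alias table + fact CLASS), pure ------------------------------------------------------------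
  --     `(form, citeText, isClaim)`: `form` = how the tag is written; `isClaim` = fact class `claim` (an unrefereed
  --     preprint's assertion) as opposed to `printed` (refereed, published). Claims are: `@[claim …]`, docstring
  --     `[claim: …]` / `[claim]`, or ANY Prop def under `cfg.claimsPrefix` (declaration name or module) whatever its
  --     marker — even a `[cite: …]`-marked or unmarked step of a claim skeleton (`Literature.Claims.NS.Xu2024.*`).
  let underClaims (n : Name) : Bool :=
    (cfg.claimsPrefix.isPrefixOf n && n != cfg.claimsPrefix) || (declModule? env n).any (cfg.claimsPrefix.isPrefixOf ·)
  let docSaysClaim (doc : String) : Bool :=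
    containsSub doc "[claim:" || containsSub doc "[claim]" ||
      (let l := doc.toLower; containsSub l "preprint-claim" || containsSub l "[preprint claim")
  let printedInfo? (n : Name) : Option (String × String × Bool) := Id.run do   -- (form, citeText, isClaim)
    if nodeSet.contains n then return none
    let some (.defnInfo d) := env.find? n | return none
    unless d.type.getForallBody.isProp do return none
    unless inScope n do return none
    if conjSet.contains n then return none
    let doc? := docOf? env n
    -- open-conjecture veto (docstring form): an open conjecture is an obligation, never an assumable fact of either class
    if let some doc := doc? then
      let l := doc.toLower
      if containsSub l "[conjecture" || containsSub l "[open problem" || containsSub l "[open-problem" ||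
          containsSub l "[status: open" || containsSub l "[status:open" then return none
    let byLoc := underClaims n
    let byDoc := match doc? with | some d => docSaysClaim d | none => false
    if let some ts := tagsByDecl[n]? then
      if let some t := ts.find? (fun t => printedFamily.contains t.attr) then
        return some (t.attr.toString, ", ".intercalate t.args.toList, t.attr == `claim || byLoc || byDoc)
    if cfg.docTags && (declModule? env n).any (·.getRoot == cfg.literatureRoot) then
      if let some doc := doc? then
        if let some (k, a) := docPrintedTag? doc then return some (s!"doc:{k}", a, k == "claim" || byLoc || byDoc)
    -- a Prop def under the claims prefix with no marker at all is still a (nameable) claim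
    if byLoc then return some (s!"namespace:{cfg.claimsPrefix}", "", true)
    return none
  -- head classifier for `analyse` (pure; each theorem is analysed once, so each hypothesis head is looked up once per theorem)
  let headCls (h : Name) : HypCls :=
    if nodeSet.contains h then .node else
    match printedInfo? h with
    | some (_, _, true) => .claim
    | some _ => .printed
    | none => .other
  -- shapes are memoised: a theorem is analysed once even if it is a candidate for several roles
  let shapesRef ← IO.mkRef ({} : Std.HashMap Name (Option Shape))
  let shapeOf (n : Name) : MetaM (Option Shape) := do
    match (← shapesRef.get)[n]? with
    | some s => return s
    | none =>
      let s ← try analyse headCls n catch _ => pure none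
      shapesRef.modify (·.insert n s)
      return s
  -- (4) facts (printed or claim): discharge / refutation status, lazily per fact -----------------------------------
  let factMemo ← IO.mkRef ({} : Std.HashMap Name PrintedReport)
  let factOf (f : Name) : MetaM PrintedReport := do
    if let some r := (← factMemo.get)[f]? then return r
    let (form, cite, isClaim) := (printedInfo? f).getD ("?", "", false)
    let mut r : PrintedReport := { decl := f, module := moduleOf f, form, cite, cls := (if isClaim then "claim" else "printed"),
                                   arity := declArity env f }
    for cand in ix.candidates f do
      let some sh ← shapeOf cand | continue
      unless sh.conclusion == f && sh.exact && sh.hyps.isEmpty && sh.clean do continue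
      if sh.negative then r := { r with refutedBy := r.refutedBy.push cand }
      else r := { r with dischargedBy := r.dischargedBy.push cand }
    factMemo.modify (·.insert f r)
    return r
  -- (5) nodes: direct settles / refutations / printed closers / conditionals; theses --------------------------------
  let credit (sh : Shape) : Bool := sh.closedHead || cfg.creditParametrised
  let mut theses : Array ThesisReport := #[]
  for i in [0:nodeArr.size] do
    let mut row := nodeArr[i]!
    for cand in ix.candidates row.decl do
      let some sh ← shapeOf cand | continue
      unless sh.conclusion == row.decl do continue
      unless sh.exact do
        let why := if !sh.argsOk then "conclusion applies the node to terms that are not its own distinct parameters (instance / specialisation; paramsExact=false)"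
          else if !sh.levelsOk then "conclusion fixes universe levels of the node"
          else s!"unused data binders {sh.extraBinders.toList}"
        row := { row with conditional := row.conditional.push { thm := cand, reason := why } }
        continue
      let nodeHyps := sh.hyps.filter (·.cls == .node)
      let badHyps := sh.hyps.filter fun h => h.cls == .other || h.cls == .inst
      if !badHyps.isEmpty && nodeHyps.isEmpty then
        let why := "hypotheses neither nodes nor printed facts nor claims: " ++
          ", ".intercalate (badHyps.toList.map fun h => (if h.cls == .inst then "[instance] " else "") ++ h.pretty)
        row := { row with conditional := row.conditional.push { thm := cand, reason := why } }
        continue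
      if !nodeHyps.isEmpty then
        -- a THESIS targeting this node (positive) or a refutation route (negative)
        let printedHyps := sh.hyps.filter (·.cls == .printed) |>.filterMap (·.head?)
        let claimHyps := sh.hyps.filter (·.cls == .claim) |>.filterMap (·.head?)
        let extra := badHyps.map fun h => (if h.cls == .inst then "[instance] " else "") ++ h.pretty
        theses := theses.push {
          thm := cand, module := sh.module, summit := summitOfModule cfg sh.module, target := row.decl,
          targetKind := row.kind, negative := sh.negative, nodes := dedupNames (nodeHyps.filterMap (·.head?)),
          printed := dedupNames printedHyps, claims := dedupNames claimHyps, extra, exact := true, unproved := !sh.clean }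
        continue
      -- no node hypotheses; the remaining hypotheses are printed facts or claims (possibly none)
      unless sh.clean do
        let why := if sh.hasSorry then "proof uses sorry" else s!"proof uses axioms {sh.foreignAxioms.toList}"
        row := { row with pending := row.pending.push { thm := cand, reason := why } }
        continue
      unless credit sh do
        row := { row with paramInstances := row.paramInstances.push cand }
        continue
      if sh.hyps.isEmpty then
        if sh.negative then row := { row with refutedBy := row.refutedBy.push { thm := cand } }
        else row := { row with provedBy := row.provedBy.push { thm := cand } }
      else
        -- fact closer: drop discharged facts/claims; a refuted one poisons the closer; ≥ 1 live CLAIM ⇒ mod CLAIM, not mod print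
        let facts := dedupNames (sh.hyps.filterMap (·.head?))
        let mut live : Array Name := #[]          -- undischarged PRINTED facts
        let mut liveClaims : Array Name := #[]    -- undischarged CLAIMS
        let mut poisoned : Array Name := #[]
        for f in facts do
          let fr ← factOf f
          factMemo.modify (·.insert f { fr with usedBy := fr.usedBy.push cand })
          if !fr.refutedBy.isEmpty then poisoned := poisoned.push f
          else if fr.dischargedBy.isEmpty then
            if fr.cls == "claim" then liveClaims := liveClaims.push f else live := live.push f
        if !poisoned.isEmpty then
          row := { row with conditional := row.conditional.push { thm := cand, reason := s!"assumes printed fact(s)/claim(s) REFUTED in the tree: {poisoned.toList}" } }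
        else if sh.negative then
          -- `F₁ → … → ¬ C`: a refutation modulo print; modulo a CLAIM it is never credited
          if live.isEmpty && liveClaims.isEmpty then row := { row with refutedBy := row.refutedBy.push { thm := cand, via := "facts-discharged" } }
          else if liveClaims.isEmpty then row := { row with refutedBy := row.refutedBy.push { thm := cand, facts := live, via := "mod-print" } }
          else row := { row with conditional := row.conditional.push { thm := cand, reason :=
            s!"refutation modulo unrefereed CLAIM(s) {liveClaims.toList}{if live.isEmpty then "" else s!" (and printed {live.toList})"} — a claim is not a printed theorem; never credited" } }
        else if live.isEmpty && liveClaims.isEmpty then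
          row := { row with provedBy := row.provedBy.push { thm := cand, via := "facts-discharged" } }
        else if liveClaims.isEmpty then
          row := { row with modPrint := row.modPrint.push { thm := cand, facts := live } }
        else
          row := { row with modClaim := row.modClaim.push { thm := cand, facts := live, claims := liveClaims } }
    -- edges
    nodeArr := nodeArr.set! i row
  -- implicit conjunct theses `S := C₁ ∧ … ∧ Cₙ`
  if cfg.conjunctStatements then
    for n in nodeArr do
      if n.kind == "statement" then
        if let some (.defnInfo d) := env.find? n.decl then
          if let some cs := conjuncts? d.value then
            let nodesH := cs.filter nodeSet.contains
            unless nodesH.isEmpty do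
              let extra := (cs.filter fun c => !nodeSet.contains c && (printedInfo? c).isNone).map (·.toString)
              let isFactOf (claim : Bool) (c : Name) : Bool :=
                !nodeSet.contains c && (match printedInfo? c with | some (_, _, k) => k == claim | none => false)
              let printedH := cs.filter (isFactOf false)
              let claimsH := cs.filter (isFactOf true)
              theses := theses.push {
                thm := n.decl, module := n.module, summit := n.summit, target := n.decl, targetKind := "statement",
                implicit := true, nodes := dedupNames nodesH, printed := dedupNames printedH, claims := dedupNames claimsH,
                extra := extra }
  -- evidence / barrier edges
  let mut stray : Array EdgeReport := #[]
  for (attr, tag) in [(evidenceAttr, "evidence_for"), (barrierAttr, "barrier")] do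
    for (thm, target) in edgeEntries env attr do
      unless inScope thm do continue
      match nodeIdx[target]? with
      | some i => nodeArr := nodeArr.modify i fun r =>
          if tag == "barrier" then { r with barriers := r.barriers.push thm } else { r with evidence := r.evidence.push thm }
      | none =>
        stray := stray.push { thm, target, attr := tag }
        lints := lints.push { code := "edge.target-not-node", decl := thm, msg := s!"@[{tag} {target}]: {target} is neither a statement nor a registered crux" }
  -- usedBy / orphans
  let mut usedBy : Std.HashMap Name (Array Name) := {}
  for th in theses do
    for h in th.nodes do
      usedBy := usedBy.alter h fun | none => some #[th.thm] | some a => some (a.push th.thm)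
  nodeArr := nodeArr.map fun r =>
    let u := usedBy.getD r.decl #[]
    { r with usedBy := u, orphan := r.kind == "crux" && u.isEmpty }
  -- thesis fact hypotheses (printed and claims): register use + discharge state
  for th in theses do
    for f in th.printed ++ th.claims do
      let fr ← factOf f
      factMemo.modify (·.insert f { fr with usedBy := fr.usedBy.push th.thm })
  -- (6) fixpoint: thesis liveness from node statuses; a CLOSED thesis settles its target ----------------------------
  let settle (r : NodeReport) : NodeReport :=
    let status :=
      if !r.refutedBy.isEmpty then "refuted"
      else if !r.provedBy.isEmpty then "proved"
      else if !r.modPrint.isEmpty then "closed_mod_print"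
      else if !r.modClaim.isEmpty then "closed_mod_claim"
      else "open"
    { r with status, conflict := !r.refutedBy.isEmpty && (!r.provedBy.isEmpty || !r.modPrint.isEmpty) }
  nodeArr := nodeArr.map settle
  let factState ← factMemo.get
  let liveFacts (fs : Array Name) : Array Name := fs.filter fun f => match factState[f]? with
    | some fr => fr.dischargedBy.isEmpty
    | none => true
  let mut changed := true
  let mut fuel := nodeArr.size + 2
  while changed && fuel > 0 do
    changed := false
    fuel := fuel - 1
    let statusOf : Std.HashMap Name String := nodeArr.foldl (fun m r => m.insert r.decl r.status) {}
    -- what a node closed modulo facts hands down to a thesis through it: (printed facts, claims)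
    let unionOf (cs : Array Closer) (sel : Closer → Array Name) : Array Name := dedupNames ((cs.map sel).foldl (· ++ ·) #[])
    let factsOf : Std.HashMap Name (Array Name × Array Name) := nodeArr.foldl (fun m r =>
      m.insert r.decl
        (if r.status == "closed_mod_print" then (unionOf r.modPrint (·.facts), #[])
         else if r.status == "closed_mod_claim" then (unionOf r.modClaim (·.facts), unionOf r.modClaim (·.claims))
         else (#[], #[]))) {}
    theses := theses.map fun th =>
      let refuted := th.nodes.filter fun c => statusOf[c]? == some "refuted"
      let opens := th.nodes.filter fun c => statusOf[c]? == some "open"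
      let status :=
        if !refuted.isEmpty then "dead"
        else if opens.isEmpty && th.extra.isEmpty && !th.unproved && th.exact then "closed"
        else "open"
      { th with status, openNodes := opens, refutedNodes := refuted }
    let mut arr' : Array NodeReport := #[]
    for r in nodeArr do
      let mut r := r
      for th in theses do
        if th.target == r.decl && th.status == "closed" then
          let already := r.provedBy.any (·.thm == th.thm) || r.modPrint.any (·.thm == th.thm) || r.modClaim.any (·.thm == th.thm) ||
            r.refutedBy.any (·.thm == th.thm) || r.conditional.any (·.thm == th.thm)
          unless already do
            let inherited := th.nodes.map fun c => factsOf.getD c (#[], #[])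
            let facts := dedupNames (liveFacts th.printed ++ (inherited.map (·.1)).foldl (· ++ ·) #[])
            let claims := dedupNames (liveFacts th.claims ++ (inherited.map (·.2)).foldl (· ++ ·) #[])
            let via := if th.implicit then "conjuncts" else "thesis"
            changed := true
            if th.negative then
              if claims.isEmpty then
                r := { r with refutedBy := r.refutedBy.push { thm := th.thm, facts, via } }
              else
                r := { r with conditional := r.conditional.push { thm := th.thm, reason :=
                  s!"refutation route closed only modulo unrefereed CLAIM(s) {claims.toList} — a claim is not a printed theorem; never credited" } }
            else if facts.isEmpty && claims.isEmpty then
              r := { r with provedBy := r.provedBy.push { thm := th.thm, via } }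
            else if claims.isEmpty then
              r := { r with modPrint := r.modPrint.push { thm := th.thm, facts, via } }
            else
              r := { r with modClaim := r.modClaim.push { thm := th.thm, facts, claims, via } }
      arr' := arr'.push (settle r)
    nodeArr := arr'
  -- (7) summit lines, printed table, config stamp --------------------------------------------------------------------
  let summitNames := dedupNames (nodeArr.map fun r => Name.mkSimple r.summit) |>.map (·.toString)
  let summits := summitNames.map fun s =>
    let ns := nodeArr.filter (·.summit == s)
    let count (st : String) := (ns.filter (·.status == st)).size
    { summit := s, statements := (ns.filter (·.top)).map (fun r => (r.decl, r.status)),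
      nodes := ns.size, «open» := count "open", proved := count "proved", refuted := count "refuted",
      modPrint := count "closed_mod_print", modClaim := count "closed_mod_claim", theses := (theses.filter (·.summit == s)).size,
      orphans := (ns.filter (·.orphan)).size : SummitLine }
  let printed := (← factMemo.get).fold (fun (a : Array PrintedReport) _ v => a.push v) #[] |>.qsort (fun a b => a.decl.toString < b.decl.toString)
  for p in printed do
    if p.form == "?" then
      lints := lints.push { code := "printed.unresolved", decl := p.decl, msg := "used as a fact hypothesis but no printed/claim tag resolved (internal)" }
  return { root := env.mainModule, scannedModules := ix.nModules, scannedTheorems := ix.nTheorems,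
           config := s!"{repr cfg}", summits, nodes := nodeArr, theses, printed, strayEdges := stray, lints }

/-! ## Restriction and filters (shared by `#status`, `#status_root` and the executable) -/

/-- Keep only summit `s`: its nodes, the theses targeting them, the facts those use, its stray edges and lints. -/
def Report.restrictToSummit (r : Report) (s : String) : Report :=
  let nodes := r.nodes.filter (·.summit == s)
  let keep : Std.HashSet Name := nodes.foldl (fun h n => h.insert n.decl) {}
  let theses := r.theses.filter fun t => keep.contains t.target
  let users0 : Std.HashSet Name := theses.foldl (fun h t => h.insert t.thm) {}
  let users : Std.HashSet Name := users0.insertMany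
    ((nodes.map fun n => (n.provedBy ++ n.refutedBy ++ n.modPrint ++ n.modClaim).map (·.thm) ++ n.conditional.map (·.thm)).foldl (· ++ ·) #[])
  let printed := r.printed.filter fun p => p.usedBy.any users.contains
  { r with summit := some s, summits := r.summits.filter (·.summit == s), nodes, theses, printed,
           strayEdges := r.strayEdges.filter (fun e => keep.contains e.target || theses.any (·.thm == e.thm)),
           lints := r.lints.filter fun l => keep.contains l.decl || nodes.any (·.decl == l.decl) }

/-- Merge per-summit reports (as stored by the 21 roots) into one. Nodes/theses are disjoint by construction. -/
def Report.merge (rs : Array Report) : Report :=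
  if h : rs.size = 1 then rs[0] else
  { root := `_merged, summit := none,
    scannedModules := rs.foldl (· + ·.scannedModules) 0, scannedTheorems := rs.foldl (· + ·.scannedTheorems) 0,
    config := (rs[0]?.map (·.config)).getD "",
    summits := (rs.map (·.summits)).foldl (· ++ ·) #[], nodes := (rs.map (·.nodes)).foldl (· ++ ·) #[],
    theses := (rs.map (·.theses)).foldl (· ++ ·) #[], printed := (rs.map (·.printed)).foldl (· ++ ·) #[],
    strayEdges := (rs.map (·.strayEdges)).foldl (· ++ ·) #[], lints := (rs.map (·.lints)).foldl (· ++ ·) #[] }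

structure Filter where
  summit     : Option String := none
  bottleneck : Option String := none
  /-- `open` | `proved` | `refuted` | `closed_mod_print` | `closed_mod_claim` -/
  only       : Option String := none
  experiment : Bool := false
  orphans    : Bool := false
  deriving Inhabited, Repr

def Filter.isCruxLevel (f : Filter) : Bool := f.bottleneck.isSome || f.only.isSome || f.experiment || f.orphans

def Filter.apply (f : Filter) (r : Report) : Report :=
  let r := match f.summit with | some s => r.restrictToSummit s | none => r
  let keep (n : NodeReport) : Bool :=
    (f.bottleneck.all fun b => n.notes.bottleneck == some b) &&
    (f.only.all fun s => n.status == s) &&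
    (!f.experiment || n.notes.experiment.isSome) &&
    (!f.orphans || n.orphan)
  let nodes := r.nodes.filter keep
  let live : Std.HashSet Name := nodes.foldl (fun s c => s.insert c.decl) {}
  let theses := if f.isCruxLevel then r.theses.filter (fun t => t.nodes.any live.contains || live.contains t.target) else r.theses
  { r with nodes, theses }

/-! ## Rendering (text). Default = tier K only; `notes := true` adds the tier-J columns and edge lists. -/

private def pad (s : String) (w : Nat) : String := s ++ String.ofList (List.replicate (w - min w s.length) ' ')

private def table (headers : List String) (rows : Array (List String)) : String := Id.run do
  let mut widths := headers.map (·.length)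
  for r in rows do
    widths := (widths.zip r).map fun (w, c) => max w c.length
  let line (cells : List String) := ("  ".intercalate ((cells.zip widths).map fun (c, w) => pad c w)).trimAsciiEnd.toString
  let mut out := line headers ++ "\n" ++ line (widths.map fun w => String.ofList (List.replicate w '-')) ++ "\n"
  for r in rows do out := out ++ line r ++ "\n"
  return out

private def names (xs : Array Name) : String := ", ".intercalate (xs.toList.map (·.toString))

def Closer.text (c : Closer) : String :=
  c.thm.toString ++ (if c.claims.isEmpty then "" else s!" mod CLAIM [{names c.claims}]") ++
    (if c.facts.isEmpty then "" else s!" mod [{names c.facts}]") ++ (if c.via == "direct" then "" else s!" ({c.via})")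

def NodeReport.byText (n : NodeReport) : String :=
  match n.status with
  | "proved" => "; ".intercalate (n.provedBy.toList.map (·.text))
  | "refuted" => "; ".intercalate (n.refutedBy.toList.map (·.text))
  | "closed_mod_print" => "; ".intercalate (n.modPrint.toList.map (·.text))
  | "closed_mod_claim" => "; ".intercalate (n.modClaim.toList.map (·.text))
  | _ => ""

def Report.render (r : Report) (notes := false) : String := Id.run do
  let mut out := s!"STATUS root={r.root}{match r.summit with | some s => s!" summit={s}" | none => ""} | scanned {r.scannedTheorems} theorems in {r.scannedModules} modules | tier K"
  out := out ++ (if notes then " + tier-J notes\n" else " (add --with-notes for tier-J judgements, evidence/barrier lists)\n")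
  -- summits
  let sumRows := r.summits.map fun s =>
    [s.summit, ", ".intercalate (s.statements.toList.map fun (d, st) => s!"{d} [{st}]"), toString s.nodes, toString s.open,
     toString s.proved, toString s.refuted, toString s.modPrint, toString s.modClaim, toString s.theses, toString s.orphans]
  out := out ++ "\n" ++ table ["summit", "statement [status]", "nodes", "open", "proved", "refuted", "mod-print", "mod-claim", "theses", "orphans"] sumRows
  -- nodes
  let nodeRows := r.nodes.map fun n =>
    let flagsK := (if n.conflict then ["CONFLICT"] else []) ++ (if n.orphan then ["orphan"] else []) ++
      (if n.pending.isEmpty then [] else [s!"pending:{n.pending.size}"]) ++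
      (if n.conditional.isEmpty then [] else [s!"cond:{n.conditional.size}"]) ++
      (if n.paramInstances.isEmpty then [] else [s!"proved_instance?:{n.paramInstances.size}"])
    let base := [n.decl.toString, n.kind, n.summit, n.status, n.byText, " ".intercalate flagsK]
    if notes then
      base ++ [n.notes.bottleneck.getD (if n.kind == "crux" then "MISSING" else ""), (if n.notes.experiment.isSome then "yes" else ""),
               (if n.evidence.isEmpty then "" else toString n.evidence.size), (if n.barriers.isEmpty then "" else toString n.barriers.size),
               n.notes.source.getD "" ++ (if n.notes.legacy then " (legacy tag)" else "")]
    else base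
  let hdr := ["node", "kind", "summit", "status", "by", "flags"] ++ (if notes then ["bottleneck", "exp", "ev", "bar", "source"] else [])
  out := out ++ "\n" ++ table hdr nodeRows
  -- theses
  let thRows := r.theses.map fun t =>
    let detail := match t.status with
      | "dead" => s!"refuted: {names t.refutedNodes}"
      | "open" => (if t.openNodes.isEmpty then "" else s!"open: {names t.openNodes}") ++
          (if t.extra.isEmpty then "" else s!"{if t.openNodes.isEmpty then "" else "; "}BLOCKED by extra hyps (neither node nor printed nor claim): {t.extra.toList}") ++
          (if t.unproved then "; SORRY/AXIOM in proof" else "") ++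
          (if t.claims.isEmpty then "" else s!"; mod CLAIM [{names t.claims}]") ++ (if t.printed.isEmpty then "" else s!"; mod [{names t.printed}]")
      | _ => (if t.claims.isEmpty then "" else s!"mod CLAIM [{names t.claims}] ") ++ (if t.printed.isEmpty then "" else s!"mod [{names t.printed}]")
    [t.thm.toString ++ (if t.implicit then " (definition)" else "") ++ (if t.negative then " (REFUTATION ROUTE)" else ""),
     s!"{t.target} ({t.targetKind})", t.status, names t.nodes, detail]
  out := out ++ "\n" ++ table ["thesis", "target", "status", "nodes", "detail"] thRows
  -- per-node K details
  let mut det := ""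
  for n in r.nodes do
    let ls := (if n.conditional.isEmpty then [] else n.conditional.toList.map fun c => s!"conditional: {c.thm} — {c.reason} (listed, never credited)") ++
      (if n.pending.isEmpty then [] else n.pending.toList.map fun c => s!"pending:     {c.thm} — {c.reason}") ++
      (if n.paramInstances.isEmpty then [] else [s!"proved_instance?: {names n.paramInstances} (parametrised node proved for its own parameters; params_exact=true, not credited: creditParametrised=false)"]) ++
      (if notes then
        (if n.evidence.isEmpty then [] else [s!"evidence:    {names n.evidence}"]) ++
        (if n.barriers.isEmpty then [] else [s!"barrier:     {names n.barriers}"]) ++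
        (match n.notes.experiment with | some e => [s!"experiment:  {e}"] | none => [])
       else [])
    unless ls.isEmpty do
      det := det ++ s!"{n.decl} [{n.status}]\n" ++ String.join (ls.map fun l => "    " ++ l ++ "\n")
  unless det.isEmpty do out := out ++ "\n" ++ det
  -- facts in use (printed facts and claims; `class` never merges them)
  unless r.printed.isEmpty do
    let pRows := r.printed.map fun p =>
      [p.decl.toString, p.cls, p.form, (if p.cite.length ≤ 50 then p.cite else String.ofList (p.cite.toList.take 50) ++ "…"),
       (if p.dischargedBy.isEmpty then (if p.refutedBy.isEmpty then "assumed" else s!"REFUTED by {names p.refutedBy}") else s!"discharged by {names p.dischargedBy}"),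
       toString p.usedBy.size]
    out := out ++ "\n" ++ table ["fact (used)", "class", "form", "cite", "state", "uses"] pRows
  if notes then
    unless r.strayEdges.isEmpty do
      out := out ++ "\nstray edges (target is not a node): " ++ ", ".intercalate (r.strayEdges.toList.map fun e => s!"@[{e.attr} {e.target}] {e.thm}") ++ "\n"
    unless r.lints.isEmpty do
      out := out ++ "\nlints (tier J):\n" ++ String.join (r.lints.toList.map fun l => s!"  {l.code}: {l.decl} — {l.msg}\n")
  return out

/-- JSON output. Tier-J fields are always present in JSON (consumers filter); `notes := false` blanks them so that a
K-only consumer cannot read judgements by accident. -/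
def Report.toJsonDoc (r : Report) (notes := false) : Json :=
  if notes then toJson r
  else
    let nodes := r.nodes.map fun n => { n with notes := ({} : Notes), evidence := #[], barriers := #[] }
    let r' : Report := { r with nodes := nodes, lints := #[], strayEdges := #[] }
    toJson r'

/-! ## Status roots: `#status_root S` stores the summit's report in the root's `.olean`; nothing is logged -/

/-- Per-root stored reports (compressed JSON strings, one per `#status_root`). Concatenated on import, so an
environment importing the 21 roots sees 21 entries. Strings (not structures) so that the executable's optional
direct `.olean` read is layout-stable. -/
initialize statusRootExt : SimplePersistentEnvExtension String (Array String) ←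
  registerSimplePersistentEnvExtension {
    name          := `HarnessLib.Status.statusRootExt
    addEntryFn    := Array.push
    addImportedFn := fun arrs => arrs.foldl (· ++ ·) #[]
  }

/-- Stored reports visible from `env`, parsed. Malformed entries are reported as `Except.error`. -/
def storedReports (env : Environment) : Array (Except String Report) :=
  (statusRootExt.getState env).map fun s => do
    let j ← Json.parse s
    fromJson? j

/-- Run `classify` without a heartbeat budget (big cones) . -/
def classifyUnbounded (cfg : Config := {}) : MetaM Report :=
  withTheReader Core.Context (fun c => { c with maxHeartbeats := 0 }) (classify cfg)

/-- `#status_root S` — body of `Summits/<S>/Status/Root.lean`: classify the imported cone, restrict to summit `S`, store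
the report (JSON) in this module's `.olean` for `status` to read. Emits NO message (Lake replays module logs on every
build). Errors only if no module `Summits.S.*` is imported (a mis-generated root). -/
syntax (name := statusRootCmd) "#status_root " ident : command

@[command_elab statusRootCmd] def elabStatusRoot : CommandElab := fun stx => do
  let s := stx[1].getId.toString
  let cfg : Config := { includeHere := false }
  let env ← getEnv
  let pref := cfg.summitRoot ++ Name.mkSimple s
  unless env.header.modules.any (fun m => pref.isPrefixOf m.module) do
    throwError "#status_root {s}: no module {pref}.* is imported by this root — its import list must be the summit's Statement/Theses/Theorems modules"
  let rep ← liftTermElabM <| classifyUnbounded cfg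
  let rep := rep.restrictToSummit s
  modifyEnv fun env => statusRootExt.addEntry env (rep.toJsonDoc (notes := true)).compress

/-- `#status [Summit] [json] [notes] [legacy] [orphans]` — print the derived status of everything visible from this file
(imports + the file itself). `json`: machine-readable; `notes`: add tier-J columns; `legacy`: also read
`@[route_item … "crux"]`/`@[conjecture]` defs as cruxes; any other word = summit filter. For humans; never in tree files.
Statuses: `open | proved | refuted | closed_mod_print | closed_mod_claim` (the last = closed only modulo an unrefereed claim). -/
syntax (name := statusCmd) "#status" (ppSpace ident)* : command

@[command_elab statusCmd] def elabStatus : CommandElab := fun stx => do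
  let words := stx[1].getArgs.map (·.getId.toString)
  let flag (w : String) := words.contains w
  let summit? := words.find? fun w => !["json", "notes", "legacy", "orphans"].contains w
  let cfg : Config := { legacyCruxTags := flag "legacy" }
  let rep ← liftTermElabM <| classifyUnbounded cfg
  let rep := ({ summit := summit?, orphans := flag "orphans" } : Filter).apply rep
  if flag "json" then logInfo (rep.toJsonDoc (notes := flag "notes")).compress
  else logInfo (rep.render (notes := flag "notes"))

end HarnessLib.Status
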